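import Summits.BirchSwinnertonDyer.Rank1Residual.X2.ResidualDevissageGoodOrdinary
import Summits.BirchSwinnertonDyer.Rank1Residual.X2.GreenbergVatsalCaseOne
import Literature.NumberTheory.EllipticCurves.GreenbergVatsal2000.ResidualLifting
import Literature.NumberTheory.EllipticCurves.Greenberg1999.MuInvariantParity
import HarnessLib

/-!
# Greenberg–Vatsal Thm. (1.3) IN ITS PRINTED SETTING (good ordinary Eisenstein prime), CASE 1:
# the ASSEMBLY `(16) + Thm. (3.11)/(28)/p. 43 + (9) ⟹ μ(L_p(E)) = 0 ∧ λ(L_p(E)) = λ(X(E/ℚ_∞))`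
# for a rational line RAMIFIED at `p` and EVEN (cell `b2b-bsdres`, unit `b2b-bsdres-eisenstein-p2`,
# gen 20; X2-GAP §24.6 3(i) / §25)

HONEST FRAMING (run/shared/lean/b2b/bsd-rank1-residual/, verbatim in every file): the goal of the
cell is to DELETE the COMBINATION-SHAPED residual classes of the Birch–Swinnerton-Dyer formula for
ALL analytic-rank `≤ 1` elliptic curves over `ℚ` — "full BSD formula for every rank `≤ 1` curve in
class `C`" assembled STRICTLY from published theorems — so that the rank-`≤ 1` remainder becomes
exactly the CONSTRUCTION-SHAPED classes, which are TYPED (missing-input `Prop`s), NOT attempted.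
This is not "finishing BSD". Research route; NO CLAIM BEYOND STATED CLASSES; nothing here changes
a label (X1's GV-parity cells are COVERED by the PRINTED GV Thm. (1.3) = the registered fact
`GreenbergVatsal2000.thm13_charIdeal_eq_of_gvPar`; this file is a step of the kernel RE-DERIVATION
of that printed theorem from GV's numbered §2/§3 statements — a cross-check of the X2a chain
(flag `GV00-mult-asserted`) in the paper's own setting; it books nothing). THEOREMS ONLY (no `def`,
no named fact, no `sorry`); the analytic input enters as a DISPLAYED HYPOTHESIS `hAn` whose type is
word for word the body of the Literature reading-fact
`GreenbergVatsal2000.nonPrimitive_unitContent_and_lambda_eq_residual_of_lineRamifiedEven_goodOrd`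
(GV Thm. (3.11) + (28) + p. 43, good ordinary case; proposal p253710).

WHAT. Gen 17 (`X2/GreenbergVatsalAnalyticTransfer`, `X2/GreenbergVatsalCaseOne`) assembled GV's
proof of Thm. (1.3) at a MULTIPLICATIVE prime: (A) display (16) `E`-side
`#H¹(ℚ_Σ/ℚ_∞, Φ₀)·#S^{Σ₀}_{E[p]/Φ₀}(ℚ_∞) = p^{λ(X)+Σδ+e}` (kernel, gen 16) + (C) the printed analytic
statement on `b·∏𝒫` + (D) display (9) (kernel, gen 17) ⟹ `μ(b) = 0 ∧ ord_T(b mod p) =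
ord_T(T^e·f_E mod p)`. The cancellation core
`GreenbergVatsalAnalyticTransferCore.unitContent_and_order_eq_of_order_nonPrimitive_eq` is
reduction-type free (parameter `e`). Gen 19 supplied (A) at a GOOD ORDINARY prime
(`ResidualDevissageGoodOrdinary.natCard_line_mul_quotSelmer_eq_of_goodOrd`, `e = 0`, from A115,
A116, GV p. 26 and the lifting property). THIS FILE runs the assembly with `e = 0` at a good
ordinary prime:

* §1 `unitContent_and_order_eq_of_card_eq_of_goodOrd` — (A)+(C)+(D) ⟹ `HasUnitContent b ∧
  ord_T(b mod p) = ord_T(f_E mod p)` for any generator `f_E` of `char_Λ X`, `μ(X) = 0`;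
* §2 **`caseOne_clause_goodOrd`** — for `E/ℚ` globally minimal, `p` odd GOOD ORDINARY, `Φ₀` a
  rational line RAMIFIED at `p` and EVEN, `κ` cyclotomic with generator `γ`, `f` the newform,
  `ϖ·Ω_E = Ω⁺_f`, a dual datum `D` with `char_Λ X = (f_E)`: EVERY `b ∈ Λ` with
  `ι b = ϖ · padicLFunction f (unitRoot W p)` (the Néron-normalised Mazur–Swinnerton-Dyer function,
  GV (3)) has unit content and `ord_T(b mod p) = ord_T(f_E mod p)` — i.e. `μ^{anal}_E = 0` and
  `λ^{anal}_E = λ^{alg}_E` (with `μ^{alg}_E = 0`: Greenberg 1999 Prop. 5.10, `hG`), GV Thm. (1.3)'s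
  conclusion in CASE 1 — from the registered facts `hGV` (GV p. 26 / Greenberg Props. 2.2–2.4,
  p221999), `hA` (A115), `hB` (A116), `hG` (Prop. 5.10), `hLiftF` (GV p. 28/30 lifting, A195 =
  `residualEpsilon_surjOn_of_lineRamifiedEven`, consumed DEFINITIONALLY through the Literature twin
  vocabulary) and the displayed analytic hypothesis `hAn`.

References: [GreenbergVatsal2000] Thm. (1.3); §1 (3), (8)–(9); §2 (16), pp. 26–30; §3 Thm. (3.11),
(28), p. 43; [GreenbergLNM1716] Prop. 5.10; HOME/b2b-bsdres-eisenstein-p2/X2-GAP.md §22, §24–§25.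
-/

set_option autoImplicit false

noncomputable section

open scoped Classical AddSubgroup MatrixGroups ModularForm

open PowerSeries NumberField IsDedekindDomain Field WeierstrassCurve CongruenceSubgroup
  Literature.NumberTheory.EllipticCurves Literature.NumberTheory.EllipticCurves.GreenbergVatsal2000
  Literature.NumberTheory.EllipticCurves.ModularForms
  Literature.NumberTheory.EllipticCurves.Rank1Residual
  Summit.BirchSwinnertonDyer.Rank1Residual.X2.EulerFactorAlgebra
  Summit.BirchSwinnertonDyer.Rank1Residual.X2.EulerFactorInvariants
  Summit.BirchSwinnertonDyer.Rank1Residual.X2.GreenbergVatsalAnalyticTransferCore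
  Summit.BirchSwinnertonDyer.Rank1Residual.X2.ResidualDevissageGoodOrdinary

namespace Summit.BirchSwinnertonDyer.Rank1Residual.X2.GreenbergVatsalCaseOneGoodOrdinary

/-! ## §1. (A)+(C)+(D) at a good ordinary prime (`e = 0`) -/

section Assembly

variable (W : WeierstrassCurve ℚ) [W.IsGloballyMinimal] [W.IsElliptic] (p : ℕ) [hp : Fact p.Prime]
  (κ : ZpExtension ℚ p) {γ : absoluteGaloisGroup ℚ} (S₀ : Finset (HeightOneSpectrum (𝓞 ℚ)))
  {Φ₀ : AddSubgroup (W.geomTorsion (p : ℤ))} (hΦ : IsRationalLine W p Φ₀)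

/-- **GOOD ORDINARY odd `p`, GV case 1 — the `λ`/`μ^{anal}` clause from ONE displayed analytic
hypothesis.** Inputs: the registered algebraic facts `hGV` (GV p. 26 `im κ_𝔭 ⊇ L_𝔭`, p221999),
`hA` (A115, GV (6)–(7)), `hB` (A116, GV Prop. 2.5 divisibility); `κ` cyclotomic with topological
generator `γ`; `Σ₀ ∌ p` finite with every bad prime inside; a dual datum `D` of `Sel_{p^∞}(E/ℚ_∞)`
with `X` f.g. torsion and `μ(X) = 0`; the rational line `Φ₀` ramified at `p` and even; the lifting
property `hlift` (`H²(ℚ_Σ/ℚ_∞, Φ) = 0`, GV p. 30); and the analytic statement (C) for the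
NON-PRIMITIVE element `b·∏_{ℓ∈Σ₀}𝒫_ℓ` (`= ϖ·L_{Σ₀}(E/ℚ,T)` under `ι`): unit content and
`p^{ord_T} = #H¹(ℚ_Σ/ℚ_∞, Φ₀)·#S^{Σ₀}_{E[p]/Φ₀}(ℚ_∞)`. Output: `b` has unit content and
`ord_T(b mod p) = ord_T(f_E mod p)` for any generator `f_E` of `char_Λ X` — via gen 19's display
(16) at a good ordinary prime and gen 17's cancellation core with `e = 0`.
[cite: GreenbergVatsal2000, §2 (16) pp. 28–30 and §3 p. 43] -/
theorem unitContent_and_order_eq_of_card_eq_of_goodOrd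
    (hGV : imKummer_ge_greenbergCondition_at_p) (hA : lambda_nonPrimitive_eq_add_sum_delta)
    (hB : divisible_nonPrimitiveSelmerInfty_of_mu_eq_zero)
    (hκ : κ.IsCyclotomic) (hγ : κ.IsTopGenerator γ) (hp2 : p ≠ 2)
    (hgood : W.HasGoodReductionAtPrime p) (hord : ¬ (p : ℤ) ∣ W.frobeniusTrace p)
    (hS₀ : ∀ v ∈ S₀, ((p : ℕ) : 𝓞 ℚ) ∉ v.asIdeal)
    (hS : ∀ v : HeightOneSpectrum (𝓞 ℚ), v ∉ S₀ → ((p : ℕ) : 𝓞 ℚ) ∉ v.asIdeal →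
      W.HasGoodReductionAt v)
    (D : W.SelmerDualData κ γ) [Module.Finite (IwasawaAlgebra p) D.X] (hX : D.IsTorsion)
    (hμ : D.mu = 0) (hram : ¬ LineUnramifiedAt W p Φ₀) (heven : LineEven W p Φ₀)
    (hlift : ∀ s ∈ ResidualDevissageSelmer.quotSelmer κ.kerSubgroup
        (ResidualDevissageLine.lineSub Φ₀ hΦ).Quot p (↑S₀ : Set (HeightOneSpectrum (𝓞 ℚ))),
      ∃ x ∈ GreenbergVatsal2000.unramifiedOutside κ.kerSubgroup
          ↥((↥(W.geomPrimaryTorsion p))[(p : ℤ)]) p (↑S₀ : Set (HeightOneSpectrum (𝓞 ℚ))),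
        ResidualDevissageSelmer.subH1 κ.kerSubgroup (ResidualDevissageLine.lineSub Φ₀ hΦ).proj
          (ResidualDevissageLine.lineSub Φ₀ hΦ).proj_smul x = s)
    {b : IwasawaAlgebra p}
    (hC : HasUnitContent (b * eulerFactorProduct W p S₀) ∧
      p ^ (PowerSeries.map (PadicInt.toZMod (p := p)) (b * eulerFactorProduct W p S₀)).order.toNat =
        Nat.card (GreenbergVatsal2000.unramifiedOutside κ.kerSubgroup
            (ResidualDevissageLine.lineSub Φ₀ hΦ).Sub p (↑S₀ : Set (HeightOneSpectrum (𝓞 ℚ)))) *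
          Nat.card (ResidualDevissageSelmer.quotSelmer κ.kerSubgroup
            (ResidualDevissageLine.lineSub Φ₀ hΦ).Quot p (↑S₀ : Set (HeightOneSpectrum (𝓞 ℚ)))))
    {fE : IwasawaAlgebra p} (hchar : D.charIdeal = Ideal.span {fE}) :
    HasUnitContent b ∧
      (PowerSeries.map (PadicInt.toZMod (p := p)) b).order =
        (PowerSeries.map (PadicInt.toZMod (p := p)) fE).order := by
  have hS₀' : ∀ v ∈ S₀, Rat.HeightOneSpectrum.natGenerator v ≠ p :=
    fun v hv => natGenerator_ne_of_natCast_not_mem v (hS₀ v hv)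
  have hΔ : ¬ (p : ℤ) ∣ minimalDiscriminantInt W :=
    W.not_dvd_minimalDiscriminantInt_of_hasGoodReductionAtPrime' p hgood
  obtain ⟨hbu, hC⟩ := hC
  have hA' := natCard_line_mul_quotSelmer_eq_of_goodOrd W p κ S₀ hΦ hGV hA hB hκ hγ hp2 hgood hord hΔ
    hS₀ hS D hX hμ hram heven hlift
  rw [hA'] at hC
  have hexp := pow_right_injective_prime (p := p) hC
  have hfin : (PowerSeries.map (PadicInt.toZMod (p := p)) (b * eulerFactorProduct W p S₀)).order ≠ ⊤ := by
    rw [Ne, PowerSeries.order_eq_top]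
    exact (hasUnitContent_iff_map_toZMod_ne_zero _).mp hbu
  have hord' : (PowerSeries.map (PadicInt.toZMod (p := p)) (b * eulerFactorProduct W p S₀)).order =
      ((lambdaInvariant p D.X + ∑ v ∈ S₀, delta W p v + 0 : ℕ) : ℕ∞) := by
    rw [add_zero, ← hexp, ENat.coe_toNat hfin]
  have h := unitContent_and_order_eq_of_order_nonPrimitive_eq W S₀ hp2 hS₀' D hX hμ hchar 0 hbu hord'
  rwa [Nat.cast_zero, add_zero] at h

end Assembly

/-! ## §2. CASE 1 of GV Thm. (1.3) at a good ordinary prime, from registered facts + `hAn` -/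

/-- **GV Thm. (1.3), CASE 1 (rational line RAMIFIED at `p` and EVEN), at a GOOD ORDINARY prime —
`μ^{anal}_E = 0` and `λ^{anal}_E = λ^{alg}_E`.** For `E/ℚ` globally minimal, `p ≠ 2` of good
ordinary reduction, `κ` cyclotomic with topological generator `γ`, `f` the newform of `E`,
`ϖ·Ω_E = Ω⁺_f`, any dual datum `D` of `Sel_{p^∞}(E/ℚ_∞)` and any generator `f_E` of `char_Λ X`:
every `b ∈ Λ` with `ι b = ϖ · padicLFunction f (unitRoot W p)` (`= L(E/ℚ,T)`, GV (3)) has unit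
content and `ord_T(b mod p) = ord_T(f_E mod p)`. Inputs: registered facts `hGV` (p221999), `hA`
(A115), `hB` (A116), Greenberg 1999 Prop. 5.10 (`hG`: torsion, `μ(X) = 0`), the lifting
reading-fact `hLiftF` (GV p. 28/30, A195; consumed definitionally through the Literature twin
vocabulary `residualQuotSelmer`/`residualTorsionH1`/`residualEpsilon`), and the DISPLAYED analytic
hypothesis `hAn` = the body of
`GreenbergVatsal2000.nonPrimitive_unitContent_and_lambda_eq_residual_of_lineRamifiedEven_goodOrd`
(GV Thm. (3.11) + (28) + p. 43 in the printed good ordinary case). `Σ₀ :=` the bad places `∤ p`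
(`GreenbergVatsalCaseOne.exists_finset_bad_not_mem`). [cite: GreenbergVatsal2000, Thm. (1.3) (proof, p. 43) with §2 (16)]
[cite: GreenbergLNM1716, Prop. 5.10 (PDF p. 147)] -/
theorem caseOne_clause_goodOrd
    (hGV : imKummer_ge_greenbergCondition_at_p) (hA : lambda_nonPrimitive_eq_add_sum_delta)
    (hB : divisible_nonPrimitiveSelmerInfty_of_mu_eq_zero)
    (hG : Greenberg1999.prop510_isTorsion_hasUnitContent_of_gvPar)
    (hLiftF : residualEpsilon_surjOn_of_lineRamifiedEven)
    (hAn : ∀ (W : WeierstrassCurve ℚ) [W.IsGloballyMinimal] [W.IsElliptic] (p : ℕ) [Fact p.Prime]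
      (κ : ZpExtension ℚ p) {N : ℕ} [NeZero N] (f : CuspForm (Gamma0 N) 2)
      (S₀ : Finset (HeightOneSpectrum (𝓞 ℚ)))
      (Φ₀ : AddSubgroup (W.geomTorsion (p : ℤ))) (hΦ : IsRationalLine W p Φ₀),
      p ≠ 2 → W.HasGoodReductionAtPrime p → ¬ (p : ℤ) ∣ W.frobeniusTrace p → κ.IsCyclotomic →
      ¬ LineUnramifiedAt W p Φ₀ → LineEven W p Φ₀ → IsNewformOf W f →
      (∀ v ∈ S₀, ((p : ℕ) : 𝓞 ℚ) ∉ v.asIdeal) →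
      (∀ v : HeightOneSpectrum (𝓞 ℚ), v ∉ S₀ → ((p : ℕ) : 𝓞 ℚ) ∉ v.asIdeal →
        W.HasGoodReductionAt v) →
      ∀ (ϖ : ℚ), (ϖ : ℝ) * W.realPeriodRat = plusPeriod f →
      ∀ (b : IwasawaAlgebra p),
        iwasawaToPowerSeries p b =
          PowerSeries.C ((ϖ : ℚ) : ℚ_[p]) * padicLFunction f (unitRoot W p : ℚ_[p]) →
        HasUnitContent (b * eulerFactorProduct W p S₀) ∧
          p ^ (PowerSeries.map (PadicInt.toZMod (p := p)) (b * eulerFactorProduct W p S₀)).order.toNat =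
            Nat.card (residualLineH1 W p κ S₀ Φ₀ hΦ) * Nat.card (residualQuotSelmer W p κ S₀ Φ₀ hΦ))
    (W : WeierstrassCurve ℚ) [W.IsElliptic] [W.IsGloballyMinimal] (p : ℕ) [Fact p.Prime]
    {κ : ZpExtension ℚ p} {γ : absoluteGaloisGroup ℚ} {N : ℕ} [NeZero N]
    {f : CuspForm (Gamma0 N) 2}
    (hp : p ≠ 2) (hgood : W.HasGoodReductionAtPrime p) (hord : ¬ (p : ℤ) ∣ W.frobeniusTrace p)
    {Φ₀ : AddSubgroup (W.geomTorsion (p : ℤ))} (hΦ : IsRationalLine W p Φ₀)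
    (hram : ¬ LineUnramifiedAt W p Φ₀) (heven : LineEven W p Φ₀)
    (hκ : κ.IsCyclotomic) (hγ : κ.IsTopGenerator γ) (hf : IsNewformOf W f)
    (D : W.SelmerDualData κ γ) (ϖ : ℚ) (hϖ : (ϖ : ℝ) * W.realPeriodRat = plusPeriod f)
    (fE : IwasawaAlgebra p) (hchar : D.charIdeal = Ideal.span {fE}) :
    ∀ (b : IwasawaAlgebra p),
      iwasawaToPowerSeries p b =
        PowerSeries.C ((ϖ : ℚ) : ℚ_[p]) * padicLFunction f (unitRoot W p : ℚ_[p]) →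
      HasUnitContent b ∧
        (PowerSeries.map (PadicInt.toZMod (p := p)) b).order =
          (PowerSeries.map (PadicInt.toZMod (p := p)) fE).order := by
  intro b hb
  -- the cell's standing data: Σ₀, finiteness, torsion, μ = 0
  obtain ⟨S₀, hS₀, hS⟩ := GreenbergVatsalCaseOne.exists_finset_bad_not_mem W p
  haveI : Module.Finite (IwasawaAlgebra p) D.X :=
    WeierstrassCurve.SelmerDualData.module_finite_of_isCyclotomic W κ hκ D hγ
  have hpar : GVPar W p := ⟨Φ₀, hΦ, Or.inl ⟨hram, heven⟩⟩
  obtain ⟨hX, g, hcharg, hug⟩ := hG.of_goodOrd W p hp hgood hord hpar hκ hγ D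
  have hμ : D.mu = 0 := (mu_eq_zero_iff_hasUnitContent D hX hcharg).mpr hug
  -- the lifting (GV p. 28/30) and the analytic statement (GV §3), definitionally in gen 16's terms
  have hC := hAn W p κ f S₀ Φ₀ hΦ hp hgood hord hκ hram heven hf hS₀ hS ϖ hϖ b hb
  exact unitContent_and_order_eq_of_card_eq_of_goodOrd W p κ S₀ hΦ hGV hA hB hκ hγ hp hgood hord
    hS₀ hS D hX hμ hram heven (hLiftF W p κ S₀ Φ₀ hΦ hp hκ hram heven hS₀ hS) hC hchar

end Summit.BirchSwinnertonDyer.Rank1Residual.X2.GreenbergVatsalCaseOneGoodOrdinary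

end
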